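import Summits.BirchSwinnertonDyer.BirchSwinnertonDyer.Theorems.KatoDescentPotSupersingularWildUpperNonsurjTowerHeegner
import Summits.BirchSwinnertonDyer.BirchSwinnertonDyer.Theorems.KatoDescentPotSupersingularWildUpperDefectOfSplit
import Summits.BirchSwinnertonDyer.BirchSwinnertonDyer.Theorems.KatoDescentPotSupersingularWildUpperReducibleOfHull
import HarnessLib

/-!
# Route `KatoDescentPotSupersingular` (rung K9, cell `bsd-potss`): the PARENT node U₀
# `WildUpperDefectRankZero` (item stmt-BirchSwinnertonDyer-19197) in its sharpest conditional form —
# hull readings (reducible rows) ∧ Heegner road (Tamagawa–Manin-clean irreducible rows, from L₀ and the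
# residual `WildRankOne`) ∧ Coates–Sujatha (A) on the Tamagawa–Manin-DIRTY non-CM irreducible rows only
# (a `--supports … --as helper` file; seat `bsd-potss-k9-c4` g2; nothing booked, BSD not proved by any of this)

The find-verdict of seat `bsd-potss-k9-c4` for its item, in one declaration. U₀ (Kato's defect rows of the
rank-`0` upper half `ord₃ #Ш ≤ ord₃ #Ш_an` on the wild class O6) is derived by the CLOSED glue
`WildUpperDefectOfSplit` (p418391) from its two row children and the cite-level `KatoTamagawaExactInputs`.
The children, as of this seat's generation 2:

* REDUCIBLE rows (child 19190): seat kmc's `wildUpperReducibleDefect_of_hullReadingsSharp` (p420004) —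
  readings M1 `KatoHull.MemberRealizable`, M2 `KatoHull.DivisibilityReading`, M3♯ `KatoHull.ExactCountReading`
  of Kato's Euler-system module at the hull (Kato 2004 Thm. 12.4–12.6, 13.14, §14.14, Prop. 14.16 (2);
  Wuthrich 2014 Lemma 14 — printed theorems read at an object the tree does not yet construct, definition
  request D-O6-2″) + Cassels; no parity / torsion hypothesis;
* IRREDUCIBLE non-tower-surjective rows (child 19189): this seat's Heegner road (parts 1–2,
  `…WildUpperHeegnerTwist`, `…WildUpperNonsurjTowerHeegner`): the Tamagawa–Manin-CLEAN rows from published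
  facts + L₀ (rationality) + the residual `WildRankOne` (lower half of the rank-one twist); the
  Tamagawa–Manin-DIRTY non-CM rows from Coates–Sujatha's (A) through Kato 14.5 (3) in the fine-Selmer
  reading (`PublishedInputsFineSelmerCM`, p420034); the (void) CM rows from Burungale–Flach.

`wildUpperDefectRankZero_of_hullSharp_of_heegner_of_fineSelmerSharp` composes them: **U₀ ⟸ [M1, M2, M3♯,
Cassels] ∧ [gross_zagier, kolyvagin, Matar–Nekovář, exists_isNewformOf, Bump–Friedberg–Hoffstein] ∧
`KatoTamagawaExactInputs` ∧ `PublishedInputsFineSelmerCM` ∧ L₀ ∧ `WildRankOne` ∧ [(A) on the ♯ non-CM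
rows of 19189]** — one construction (the hull realisation), one open conjecture on 163 of 364 census cells,
and the route's own lower half and residual. CONDITIONAL (audit `proof.conditional`); the item is NOT
closed; BSD is not proved by any of this.

References: [Kato2004Asterisque] Thm. 12.5 (3), 12.6 (p. 222), §14.14 (p. 243), Prop. 14.16 (2) (p. 244),
Thm. 14.5 (3) (p. 236); [Wuthrich2014] Lemma 14 (p. 396); [MatarNekovar2019] Thm. 0.3, §0.11;
[GrossZagier1986] Thm. I.6.3; [BumpFriedbergHoffstein1990] Theorem; [CoatesSujatha2005] Conj. A;
[BurungaleFlach2024] Thm. 1.1, Cor. 2; [Cassels1965ArithmeticVIII]; [Miller2011LMS] Def. 1.1.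
-/

set_option autoImplicit false
-- the Theorems directory repeats the summit name (sibling precedent `KatoDescentPotSupersingularAssembly.lean`)
set_option linter.dupNamespace false

noncomputable section

open scoped Classical

namespace Summit.BirchSwinnertonDyer.BirchSwinnertonDyer.Theorems

open WeierstrassCurve Literature.NumberTheory.EllipticCurves
  Literature.NumberTheory.EllipticCurves.ModularForms
  Literature.NumberTheory.EllipticCurves.Rank1Residual
  Literature.NumberTheory.EllipticCurves.Rank1Residual.Typed
  Summit.BirchSwinnertonDyer.Rank1Residual
  Summit.BirchSwinnertonDyer.Rank1Residual.Additive
  Summit.BirchSwinnertonDyer.BirchSwinnertonDyer.Theses.KatoDescentPotSupersingular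

variable {IsHullOf : ∀ (W : WeierstrassCurve ℚ) [W.IsElliptic] [W.IsGloballyMinimal] (p : ℕ)
  [Fact p.Prime], KatoHullDescentDatum p → Prop}

/-- **U₀ `WildUpperDefectRankZero` (item stmt-BirchSwinnertonDyer-19197), sharpest conditional form**
(type = the route decl verbatim): from the hull readings M1/M2/M3♯ + Cassels (reducible rows, kmc
p420004), the published Heegner-road facts (`hGZ`, `hKo`, `hMN`, `hnf`, `hBFH`), the cite-level
`KatoTamagawaExactInputs` (`hK`) and `PublishedInputsFineSelmerCM` (`hF`), the lower-half crux L₀ (`h₂`,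
rationality only), the declared residual `WildRankOne` (`hR`, lower half of the rank-one twist only) and
Coates–Sujatha's (A) on the Tamagawa–Manin-dirty non-CM rows of 19189 (`hCSsharp`). The composition is
the closed glue `wildUpperDefectOfSplit_proof` (p418391). Conditional; the item is NOT closed.
[cite: Kato2004Asterisque, Thm. 12.6 (p. 222), Prop. 14.16 (2) (p. 244)] [cite: MatarNekovar2019, Thm. 0.3 (p. 456), §0.11 (p. 457)]
[cite: CoatesSujatha2005, Conjecture A] [cite: Cassels1965ArithmeticVIII] -/
theorem wildUpperDefectRankZero_of_hullSharp_of_heegner_of_fineSelmerSharp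
    (hM : KatoHull.MemberRealizable IsHullOf) (hD : KatoHull.DivisibilityReading IsHullOf)
    (hC : KatoHull.ExactCountReading IsHullOf) (hCassels : bsdRHS_eq_of_isIsogenous)
    (hGZ : ∀ (N : ℕ) [NeZero N] (W : WeierstrassCurve ℚ) (K : Type) [Field K] [NumberField K],
      gross_zagier N W K)
    (hKo : ∀ (N : ℕ) [NeZero N] (W : WeierstrassCurve ℚ) (K : Type) [Field K] [NumberField K],
      kolyvagin N W K)
    (hMN : ∀ (N : ℕ) [NeZero N] (W : WeierstrassCurve ℚ) (K : Type) [Field K] [NumberField K],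
      MatarNekovar2019.thm03_padicValNat_card_sha_le_of_irreducible N W K)
    (hnf : exists_isNewformOf) (hBFH : bumpFriedbergHoffstein_exists_heegnerField_split_twist_simpleZero)
    (hK : Summit.BirchSwinnertonDyer.BirchSwinnertonDyer.Theses.KatoDescentPotSupersingular.KatoTamagawaExactInputs)
    (hF : Summit.BirchSwinnertonDyer.BirchSwinnertonDyer.Theses.KatoDescentPotSupersingular.PublishedInputsFineSelmerCM)
    (h₂ : WildLowerHalfRankZero) (hR : WildRankOne)
    (hCSsharp : ∀ (W : WeierstrassCurve ℚ) [W.IsElliptic] [W.IsGloballyMinimal] [Fact (3 : ℕ).Prime],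
      W.analyticRank = 0 → ClassO6 W 3 → W.HasIrreducibleModPGaloisRep 3 →
      ¬ (∀ n : ℕ, W.HasSurjectiveModNGaloisRep (3 ^ n : ℕ)) →
      (3 ∣ W.tamagawaProduct ∨ ∀ [NeZero (W.conductorNorm ℤ)]
        (D : ModularParametrizationData W (W.conductorNorm ℤ)), (3 : ℤ) ∣ D.maninConstant) →
      ¬ W.HasCM → ∀ (κ : ZpExtension ℚ 3), κ.IsCyclotomic →
        ∃ (γ : Field.absoluteGaloisGroup ℚ) (Df : W.FineSelmerDualData κ γ),
          Module.Finite ℤ_[3] (RestrictScalars ℤ_[3] (IwasawaAlgebra 3) Df.X)) :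
    Summit.BirchSwinnertonDyer.BirchSwinnertonDyer.Theses.KatoDescentPotSupersingular.WildUpperDefectRankZero :=
  wildUpperDefectOfSplit_proof
    (wildUpperNonsurjTower_of_wildLower_of_wildRankOne_of_fineSelmerSharp hGZ hKo hMN hnf hBFH hK hF h₂ hR
      hCSsharp)
    (wildUpperReducibleDefect_of_hullReadingsSharp hM hD hC hCassels hK.2.1 hK.2.2) hK

end Summit.BirchSwinnertonDyer.BirchSwinnertonDyer.Theorems

end
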